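import Literature.MathematicalPhysics.QuantumFieldTheory.Balaban1983to89.B10Eq17LocalSolution
import Summits.QuantumFields.YangMills.Theorems.BalabanUVNodesN11KernelTransportInFibreChart
import Summits.QuantumFields.YangMills.Theorems.BalabanUVNodesN11DeltaRemovalLinearFibreChart

/-!
# DAG node N11 — «we remove the δ-functions using the operator C» ([III] p. 267) AS A THEOREM, part 2 of 2:
# the linear δ-removal chart FED BY NAME to dag-n11-d's disintegration socket (`∫dB′ δ(Q̃B′ − y) g(B′)` as the density of `(g·dB′).map Q`),
# and AT PRINT'S corridor operator `h = hOpLin b₀ h` (Jacobian `∏_c |det h(c)| = |det Q_{b₀}|⁻¹`)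

HEADER — WORK-UNIT METADATA.  Cell `pub-ymgap`, YM-PLAN Track A (HUMAN RULING D-0062), WIDTH SEAT `pub-ymgap-dag-n11-w6` (R399 (3a) re-mint, g0b), node N11
[B14], route `BalabanUVNodes`, item K1⁷ `StabilityBAtRecordR13SepCoPH` = stmt-QuantumFields-20542 (helper lane, `--kind proof --supports 20542 --as helper`,
count-neutral).  [I] = [Balaban1987RG1], [III] = [Balaban1988Convergent], [13] = [Balaban1985BackgroundPropagators], [16] = [Balaban1985UV3].  Over part 1
`BalabanUVNodesN11DeltaRemovalLinearFibreChart` (the chart `Φ (y, B) = C B + H y`: `hfib_linear`, `hpush_linear`, `integral_eq_integral_chart`), dag-n11-d's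
`BalabanUVNodesN11KernelTransportInFibreChart` (★★ `map_withDensity_eq_withDensity_lintegral_chart`, ★ `lintegral∕integral_comp_avg_mul_eq_chart`) and the tree's
`B10Eq17LocalSolution.hOpLin` ∕ `B13PkLocalTerms.hOp` (print's «(hB)(b₀(c)) = h(c)B(c)», [I] p. 267 L.22–25).

WHAT THIS FILE PROVES (0 `def`, 0 `sorry`, standard axioms; hypothesis-form as in part 1: `hQH`, `hH`, `hC`, `hQC`).
§4 ★★★ `map_withDensity_linearAvg_eq` — THE SOCKET CONSUMED BY NAME: for every measurable `g ≥ 0` of the fine field,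
   `(g·dB′).map Q = (y ↦ |det (H↾corridor)| ∫⁻ dB g(CB + Hy)) · dy` — print's «∫dB′ δ(Q̃B′) g(B′)» after «B′ = CB» ([I] p. 268 L.1–3) is the value at `y = 0`
   (`|det (H↾corridor)| = |det Q_{b₀}|⁻¹`, the lit-balaban desk's `deltaQ`); ★★ `lintegral_comp_linearAvg_mul_eq` ∕ ★★ `integral_comp_linearAvg_mul_eq` — the tested
   Tonelli ∕ Bochner forms `∫ dB′ φ(Q̃B′) ρ(B′) = ∫ dy φ(y) · |det Q_{b₀}|⁻¹ ∫ dB ρ(CB + Hy)` (print's insertion of `∫ dB′ δ(Q̃B′ − y) …` under the `dy`-integral of the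
   next step, [I] (1.4) p. 260 ∕ [III] (2.21) p. 258).
§5 print's letters `H = hOpLin b₀ h` with `b₀ = e ∘ inr`: `b₀_injective_of_splitting` · `hOpLin_apply_rest` (the hypothesis `hH`) · `corridorRead_hOpLin` ·
   `funLeft_comp_hOpLin` (`H↾corridor = ⊕_c h(c)`) · ★ `abs_det_corridorRead_hOpLin` (`|det (H↾corridor)| = ∏_c |det h(c)|` — exponentiated, print's «sum of terms
   −log det S(V^{(k)}, b₀(c))», [16] p. 271) · `det_corridorBlock_mul_det_eq_one` (`det (Q ∘ hOpLin b₀ id) · det (H↾corridor) = 1`: the Jacobian IS `|det Q_{b₀}|⁻¹`,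
   «h(c) is … an inverse of a coefficient at the variable B′(b₀(c)) in (Q̃B′)(c)») · ★★ `integral_eq_integral_chart_hOpLin`
   (`∫ dB′ F(B′) = (∏_c |det h(c)|) · ∫ dy ∫ dB F(CB + hy)` for every integrable `F`).

HONEST FRAMING.  Helper lane of K1⁷; count-neutral; finite-dimensional linear algebra + Lebesgue ∕ Fubini (the identity-class step S3 of ME #37) and two
applications of dag-n11-d's socket theorems BY NAME — NO Lie–Haar chart (S1), NO Jacobian of (47)∕(17) (S2), nothing at `fieldMeasure` (director's lever);
nothing of Bałaban asserted beyond bookkeeping shape; (B4)∕(S-α) NOT closed; N11 NOT discharged; K1⁷ NOT closed; node counts unmoved.  R4 closes only the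
conditional finite-𝕋⁴ rung `BalabanLadder.UV` — NOT ℝ⁴, NOT OS, NOT a mass gap, NOT Clay.  No `sorry`, `axiom`, `def`, `instance`, `notation`.
Sources (SHAPE ∕ bookkeeping only): [I] (1.4) p.260, p.267 L.16–32, p.268 L.1–5; [III] (2.21) p.258, p.267 L.18–24; [13] Sect. E p.428; [16] p.271.
-/

noncomputable section

open MeasureTheory ProbabilityTheory
open scoped ENNReal NNReal

namespace Summit.QuantumFields.YangMills.Theorems.BalabanUVNodesN11DeltaRemovalLinearFibreChartByName

open Literature.MathematicalPhysics.QuantumFieldTheory.Balaban1983to89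
open Summit.QuantumFields.YangMills.Theorems.BalabanUVNodesN11DeltaRemovalLinearFibreChart

/-! ## §4  BY NAME through dag-n11-d's socket: the push-forward of `g·dB′` along the block averaging has density `|det Q_{b₀}|⁻¹ ∫ dB g(CB + hy)` -/

section Socket

variable {X : Type*} [NormedAddCommGroup X] [NormedSpace ℝ X] [FiniteDimensional ℝ X] [MeasureSpace X] [BorelSpace X]
  [(volume : Measure X).IsAddHaarMeasure]
variable {ι κ σ : Type*} [Fintype ι] [Fintype κ] [Fintype σ] {e : σ ⊕ κ ≃ ι}
variable {Q : (ι → X) →ₗ[ℝ] (κ → X)} {H : (κ → X) →ₗ[ℝ] (ι → X)} {C : (σ → X) →ₗ[ℝ] (ι → X)}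

/-- **★★★ «∫dB′ δ(Q̃B′ − y) g(B′)» AS A DENSITY — the socket's ★★ `map_withDensity_eq_withDensity_lintegral_chart` fed with `hpush_linear` ∕ `hfib_linear`**:
for every measurable `g ≥ 0` of the fine field, `(g·dB′).map Q = (y ↦ |det (H↾corridor)| ∫⁻ dB g(CB + Hy)) · dy`; at `y = 0` this is print's
«∫dB′ δ(Q̃B′) g(B′) = |det Q_{b₀}|⁻¹ ∫ dB g(CB)» (the desk's `deltaQ`). [cite: Balaban1987RG1, (1.4) p.260, p.268 L.1–5; Balaban1988Convergent, p.267 L.18–24; Balaban1985BackgroundPropagators, Sect. E p.428] -/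
theorem map_withDensity_linearAvg_eq (hQH : ∀ y, Q (H y) = y) (hH : ∀ y s, H y (e (Sum.inl s)) = 0)
    (hC : ∀ B s, C B (e (Sum.inl s)) = B s) (hQC : ∀ B, Q (C B) = 0) {g : (ι → X) → ℝ≥0∞} (hg : Measurable g) :
    ((volume : Measure (ι → X)).withDensity g).map Q =
      (volume : Measure (κ → X)).withDensity (fun y =>
        ENNReal.ofReal |LinearMap.det ((LinearMap.funLeft ℝ X (fun c => e (Sum.inr c))) ∘ₗ H)| * ∫⁻ B, g (C B + H y)) := by
  have h := BalabanUVNodesN11KernelTransportInFibreChart.map_withDensity_eq_withDensity_lintegral_chart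
    (ν := (volume : Measure (ι → X))) (μ := (volume : Measure (κ → X)))
    (κ := ProbabilityTheory.Kernel.const (κ → X) (volume : Measure (σ → X)))
    (avg := ⇑Q) (Ψ := fun p : (κ → X) × (σ → X) => C p.2 + H p.1)
    (J := fun _ => Real.toNNReal |LinearMap.det ((LinearMap.funLeft ℝ X (fun c => e (Sum.inr c))) ∘ₗ H)|) (S := Set.univ)
    Q.continuous_of_finiteDimensional.measurable measurable_chart measurable_const
    (hpush_linear hQH hH hC) (hfib_linear hQH hQC _) hg (fun U hU => absurd (Set.mem_univ U) hU)
  rw [h]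
  refine congrArg _ (funext fun y => ?_)
  have hmeas : Measurable fun B : σ → X => g (C B + H y) :=
    hg.comp (C.continuous_of_finiteDimensional.add continuous_const).measurable
  dsimp only
  rw [ProbabilityTheory.Kernel.const_apply, lintegral_const_mul _ hmeas]
  rfl

/-- **★★ THE TESTED TONELLI FORM** (socket ★ `lintegral_comp_avg_mul_eq_chart` by name): `∫⁻ dB′ φ(Q̃B′) g(B′) = ∫⁻ dy φ(y) · |det (H↾corridor)| ∫⁻ dB g(CB + Hy)`
for all measurable `φ, g ≥ 0`. [cite: Balaban1987RG1, (1.4) p.260, p.268 L.1–5; Balaban1988Convergent, (2.21) p.258, p.267 L.18–24] -/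
theorem lintegral_comp_linearAvg_mul_eq (hQH : ∀ y, Q (H y) = y) (hH : ∀ y s, H y (e (Sum.inl s)) = 0)
    (hC : ∀ B s, C B (e (Sum.inl s)) = B s) (hQC : ∀ B, Q (C B) = 0)
    {φ : (κ → X) → ℝ≥0∞} (hφ : Measurable φ) {g : (ι → X) → ℝ≥0∞} (hg : Measurable g) :
    ∫⁻ B', φ (Q B') * g B' = ∫⁻ y, φ y *
      (ENNReal.ofReal |LinearMap.det ((LinearMap.funLeft ℝ X (fun c => e (Sum.inr c))) ∘ₗ H)| * ∫⁻ B, g (C B + H y)) := by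
  have h := BalabanUVNodesN11KernelTransportInFibreChart.lintegral_comp_avg_mul_eq_chart
    (ν := (volume : Measure (ι → X))) (μ := (volume : Measure (κ → X)))
    (κ := ProbabilityTheory.Kernel.const (κ → X) (volume : Measure (σ → X)))
    (avg := ⇑Q) (Ψ := fun p : (κ → X) × (σ → X) => C p.2 + H p.1)
    (J := fun _ => Real.toNNReal |LinearMap.det ((LinearMap.funLeft ℝ X (fun c => e (Sum.inr c))) ∘ₗ H)|) (S := Set.univ)
    Q.continuous_of_finiteDimensional.measurable measurable_chart measurable_const
    (hpush_linear hQH hH hC) (hfib_linear hQH hQC _) hφ hg (fun U hU => absurd (Set.mem_univ U) hU)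
  rw [h]
  refine lintegral_congr fun y => ?_
  have hmeas : Measurable fun B : σ → X => g (C B + H y) :=
    hg.comp (C.continuous_of_finiteDimensional.add continuous_const).measurable
  dsimp only
  rw [ProbabilityTheory.Kernel.const_apply, lintegral_const_mul _ hmeas]
  rfl

/-- **★★ THE TESTED BOCHNER FORM** (socket ★ `integral_comp_avg_mul_eq_chart` by name): for a measurable integrable real `ρ` of the fine field and a bounded
measurable `φ` of the block field, `∫ dB′ φ(Q̃B′) ρ(B′) = ∫ dy φ(y) ∫ dB |det (H↾corridor)| ρ(CB + Hy)` — print's insertion of `∫ dB′ δ(Q̃B′ − y) …` under a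
`dy`-integral. [cite: Balaban1987RG1, (1.4) p.260, p.268 L.1–5; Balaban1988Convergent, (2.21) p.258, p.267 L.18–24] -/
theorem integral_comp_linearAvg_mul_eq (hQH : ∀ y, Q (H y) = y) (hH : ∀ y s, H y (e (Sum.inl s)) = 0)
    (hC : ∀ B s, C B (e (Sum.inl s)) = B s) (hQC : ∀ B, Q (C B) = 0)
    {ρ : (ι → X) → ℝ} (hρm : Measurable ρ) (hρ : Integrable ρ)
    {φ : (κ → X) → ℝ} (hφ : Measurable φ) {M : ℝ} (hM : ∀ y, |φ y| ≤ M) :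
    ∫ B', φ (Q B') * ρ B' = ∫ y, φ y *
      ∫ B, |LinearMap.det ((LinearMap.funLeft ℝ X (fun c => e (Sum.inr c))) ∘ₗ H)| * ρ (C B + H y) := by
  have h := BalabanUVNodesN11KernelTransportInFibreChart.integral_comp_avg_mul_eq_chart
    (ν := (volume : Measure (ι → X))) (μ := (volume : Measure (κ → X)))
    (κ := ProbabilityTheory.Kernel.const (κ → X) (volume : Measure (σ → X)))
    (avg := ⇑Q) (Ψ := fun p : (κ → X) × (σ → X) => C p.2 + H p.1)
    (J := fun _ => Real.toNNReal |LinearMap.det ((LinearMap.funLeft ℝ X (fun c => e (Sum.inr c))) ∘ₗ H)|) (S := Set.univ)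
    Q.continuous_of_finiteDimensional.measurable measurable_chart measurable_const
    (hpush_linear hQH hH hC) (hfib_linear hQH hQC _) hρm hρ (fun U hU => absurd (Set.mem_univ U) hU) hφ hM
  rw [h]
  refine integral_congr_ae (Filter.Eventually.of_forall fun y => ?_)
  dsimp only
  rw [ProbabilityTheory.Kernel.const_apply]
  simp only [Real.coe_toNNReal _ (abs_nonneg _)]

end Socket

/-! ## §5  The corridor right inverse of print, `H = hOpLin b₀ h` («(hB)(b₀(c)) = h(c)B(c)»): the Jacobian is `∏_c |det h(c)| = |det Q_{b₀}|⁻¹` -/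

section HOpLin

variable {X : Type*} [NormedAddCommGroup X] [NormedSpace ℝ X]
variable {ι κ σ : Type*} {e : σ ⊕ κ ≃ ι} {b₀ : κ → ι} {h : κ → X →ₗ[ℝ] X}
variable {Q : (ι → X) →ₗ[ℝ] (κ → X)} {C : (σ → X) →ₗ[ℝ] (ι → X)}

/-- The corridor bonds of a splitting are distinct: `b₀ = e ∘ inr` is one-to-one. [cite: Balaban1987RG1, p.267 L.17–19 (bookkeeping)] -/
theorem b₀_injective_of_splitting (hb : ∀ c, e (Sum.inr c) = b₀ c) : Function.Injective b₀ := by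
  intro c₁ c₂ h12
  have := e.injective ((hb c₁).trans (h12.trans (hb c₂).symm))
  exact Sum.inr_injective this

/-- `hOpLin b₀ h` vanishes on the remaining bonds («hB is equal to 0 everywhere, except the set {b₀(c)}») — the hypothesis `hH` of §§1–4 for print's `h`.
[cite: Balaban1987RG1, p.267 L.16–20] -/
theorem hOpLin_apply_rest (hb : ∀ c, e (Sum.inr c) = b₀ c) (y : κ → X) (s : σ) :
    B10Eq17LocalSolution.hOpLin b₀ h y (e (Sum.inl s)) = 0 := by
  rw [B10Eq17LocalSolution.hOpLin_apply]
  refine B13PkLocalTerms.hOp_eq_zero_off_range _ _ ?_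
  rintro ⟨c, hc⟩
  have := e.injective ((hb c).trans hc)
  exact Sum.inr_ne_inl this

/-- `hOpLin b₀ h` read on the corridor bonds is the block-diagonal operator `⊕_c h(c)` («(hB)(b₀(c)) = h(c)B(c)»). [cite: Balaban1987RG1, p.267 L.22–25] -/
theorem corridorRead_hOpLin (hb : ∀ c, e (Sum.inr c) = b₀ c) (y : κ → X) (c : κ) :
    B10Eq17LocalSolution.hOpLin b₀ h y (e (Sum.inr c)) = h c (y c) := by
  rw [hb, B10Eq17LocalSolution.hOpLin_apply, B13PkLocalTerms.hOp_apply_b₀ (b₀_injective_of_splitting hb)]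

/-- … as an identity of linear maps: `(read corridor) ∘ hOpLin b₀ h = LinearMap.pi (c ↦ h(c) ∘ proj c)`. [cite: Balaban1987RG1, p.267 L.22–25] -/
theorem funLeft_comp_hOpLin (hb : ∀ c, e (Sum.inr c) = b₀ c) :
    (LinearMap.funLeft ℝ X (fun c => e (Sum.inr c))) ∘ₗ B10Eq17LocalSolution.hOpLin b₀ h =
      LinearMap.pi (fun c => h c ∘ₗ LinearMap.proj c) := by
  refine LinearMap.ext fun y => funext fun c => ?_
  rw [LinearMap.comp_apply, LinearMap.funLeft_apply, corridorRead_hOpLin hb, LinearMap.pi_apply,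
    LinearMap.comp_apply, LinearMap.proj_apply]

variable [FiniteDimensional ℝ X] [Fintype κ]

/-- **★ THE JACOBIAN IN PRINT'S BLOCKWISE FORM**: `|det (hOpLin b₀ h ↾corridor)| = ∏_c |det h(c)|` — exponentiated, print's «sum of terms −log det S(V^{(k)}, b₀(c))»
with `h(c) = S(V^{(k)}, b₀(c))⁻¹` (up to the factor `L`). [cite: Balaban1985UV3, p.271; Balaban1987RG1, p.267 L.22–25] -/
theorem abs_det_corridorRead_hOpLin (hb : ∀ c, e (Sum.inr c) = b₀ c) :
    |LinearMap.det ((LinearMap.funLeft ℝ X (fun c => e (Sum.inr c))) ∘ₗ B10Eq17LocalSolution.hOpLin b₀ h)| =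
      ∏ c, |LinearMap.det (h c)| := by
  rw [funLeft_comp_hOpLin hb, LinearMap.det_pi, Finset.abs_prod]

omit [FiniteDimensional ℝ X] in
/-- **`det Q_{b₀} · det (h↾corridor) = 1`**: the corridor block of `Q` — `Q` composed with the extension by zero to the corridor bonds, `hOpLin b₀ id` — is the
inverse of `⊕_c h(c)` when `LQ̃h = I`; so the Jacobian `|det (h↾corridor)|` of §§2–4 IS `|det Q_{b₀}|⁻¹` («h(c) is … an inverse of a coefficient at the
variable B′(b₀(c)) in (Q̃B′)(c)»). [cite: Balaban1987RG1, p.267 L.22–25] -/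
theorem det_corridorBlock_mul_det_eq_one (hb : ∀ c, e (Sum.inr c) = b₀ c)
    (hQh : ∀ y, Q (B10Eq17LocalSolution.hOpLin b₀ h y) = y) :
    LinearMap.det (Q ∘ₗ B10Eq17LocalSolution.hOpLin b₀ (fun _ => LinearMap.id)) *
      LinearMap.det ((LinearMap.funLeft ℝ X (fun c => e (Sum.inr c))) ∘ₗ B10Eq17LocalSolution.hOpLin b₀ h) = 1 := by
  have hinj := b₀_injective_of_splitting hb
  have hfac : (Q ∘ₗ B10Eq17LocalSolution.hOpLin b₀ (fun _ => LinearMap.id)) ∘ₗ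
      ((LinearMap.funLeft ℝ X (fun c => e (Sum.inr c))) ∘ₗ B10Eq17LocalSolution.hOpLin b₀ h) = LinearMap.id := by
    refine LinearMap.ext fun y => ?_
    have hext : B10Eq17LocalSolution.hOpLin b₀ (fun _ => (LinearMap.id : X →ₗ[ℝ] X))
        ((LinearMap.funLeft ℝ X (fun c => e (Sum.inr c))) (B10Eq17LocalSolution.hOpLin b₀ h y)) =
        B10Eq17LocalSolution.hOpLin b₀ h y := by
      funext i
      simp only [B10Eq17LocalSolution.hOpLin_apply]
      by_cases hi : ∃ c, b₀ c = i
      · obtain ⟨c, rfl⟩ := hi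
        simp only [B13PkLocalTerms.hOp_apply_b₀ hinj, LinearMap.id_coe, id_eq, LinearMap.funLeft_apply]
        rw [hb c, B13PkLocalTerms.hOp_apply_b₀ hinj]
      · rw [B13PkLocalTerms.hOp_eq_zero_off_range _ _ hi, B13PkLocalTerms.hOp_eq_zero_off_range _ _ hi]
    rw [LinearMap.comp_apply, LinearMap.comp_apply, LinearMap.comp_apply, hext, hQh, LinearMap.id_apply]
  have := congrArg LinearMap.det hfac
  rwa [LinearMap.det_comp, LinearMap.det_id] at this

variable [MeasureSpace X] [BorelSpace X] [(volume : Measure X).IsAddHaarMeasure] [Fintype ι] [Fintype σ]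

/-- **★★ THE δ-REMOVAL IDENTITY AT PRINT'S `h`**: with `hOpLin b₀ h`, `LQ̃h = I` and the operator `C`, for every integrable `F` of the fine field
`∫ dB′ F(B′) = (∏_c |det h(c)|) · ∫ dy ∫ dB F(CB + hy)` — «we eliminate the variables B′(b₀(c)) … B′ = CB, … the measure becomes a … measure in variables B».
[cite: Balaban1987RG1, (1.4) p.260, p.267 L.16–32, p.268 L.1–5; Balaban1985BackgroundPropagators, Sect. E p.428; Balaban1985UV3, p.271] -/
theorem integral_eq_integral_chart_hOpLin (hb : ∀ c, e (Sum.inr c) = b₀ c)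
    (hQh : ∀ y, Q (B10Eq17LocalSolution.hOpLin b₀ h y) = y)
    (hC : ∀ B s, C B (e (Sum.inl s)) = B s)
    {E : Type*} [NormedAddCommGroup E] [NormedSpace ℝ E] {F : (ι → X) → E} (hF : Integrable F) :
    ∫ B', F B' = (∏ c, |LinearMap.det (h c)|) • ∫ y, ∫ B, F (C B + B10Eq17LocalSolution.hOpLin b₀ h y) := by
  rw [← abs_det_corridorRead_hOpLin hb]
  exact integral_eq_integral_chart hQh (hOpLin_apply_rest hb) hC hF

end HOpLin

end Summit.QuantumFields.YangMills.Theorems.BalabanUVNodesN11DeltaRemovalLinearFibreChartByName
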